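import Summits.FinalStateConjecture.FinalStateConjecture.Theses.ZeroEnergyKerrOrBomb

/-!
# Route ZeroEnergyKerrOrBomb — the glue `KerrOrBombModTOfCruxes`

Support item `stmt-FinalStateConjecture-17841` of route `ZeroEnergyKerrOrBomb` for the Final State
Conjecture: the propositional glue of the rev-6 target

`NonTrappingHawkingRigidity → HawkingExtensionIsKerr → ErgoregionBombModT → KerrOrBombModT`.

A Killing-mode-stable smooth stationary asymptotically flat vacuum black hole in the telescope of
the target `KerrOrBombModT` (vacuum, I⁺-regular, future-presented, `T ≠ 0` on a simply connected
domain of outer communications, a Killing–timelike collar `(U, K)` on a connected horizon, closed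
ergoregion off `U` compact modulo the stationary flow) has no zero-energy maximal null geodesic
trapped modulo the stationary flow: if it had one, `ErgoregionBombModT` would hand an exponentially
growing Killing-mode pair `(ψ, χ)` of `□_g`, smooth near `doc ∪ 𝓗⁺`, bounded towards the past far
region and not identically zero on the domain of outer communications — which the mode-stability
hypothesis forces to vanish identically there, a contradiction. Hence the non-trapping clause of
`NonTrappingHawkingRigidity` holds, the collar field `K` extends to a Killing field `K'` on the
domain of outer communications commuting with `T`, and `HawkingExtensionIsKerr` identifies the
domain of outer communications with a sub-extremal Kerr exterior. Classical logic only (the four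
telescopes are character-identical prefixes); the same ten lines are inlined in the route's
deciding theorem `closes`.
-/

-- every `Summit.FinalStateConjecture.FinalStateConjecture.…` name repeats the summit = sub-problem
-- segment (D-0017 layout, CONVENTIONS §2; lakefile sets it for the library build, a standalone
-- elaboration of this file does not see that option); the duplicate is deliberate.
set_option linter.dupNamespace false

namespace Summit.FinalStateConjecture.FinalStateConjecture.Theorems

open Summit.FinalStateConjecture.FinalStateConjecture.Theses.ZeroEnergyKerrOrBomb in
/-- **Glue of the rev-6 target of route ZeroEnergyKerrOrBomb** (item
`stmt-FinalStateConjecture-17841`):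
`NonTrappingHawkingRigidity → HawkingExtensionIsKerr → ErgoregionBombModT → KerrOrBombModT`.
Given a Killing-mode-stable hole `𝓑` with collar `(U, K)` as in the telescope of `KerrOrBombModT`,
apply `HawkingExtensionIsKerr`; its extension hypothesis is supplied by
`NonTrappingHawkingRigidity`, whose non-trapping clause is proved by contradiction: a zero-energy
maximal null geodesic `γ` on `s` confined to the stationary orbit of a compact `S ⊆ 𝓑.doc` is fed
to `ErgoregionBombModT`, whose growing Killing-mode pair `(ψ, χ)` is killed on `𝓑.doc` by the
mode-stability hypothesis, contradicting its non-vanishing at some point of `𝓑.doc`. -/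
theorem KerrOrBombModTOfCruxes_proof :
    Summit.FinalStateConjecture.FinalStateConjecture.Theses.ZeroEnergyKerrOrBomb.KerrOrBombModTOfCruxes := by
  unfold KerrOrBombModTOfCruxes
  intro hN hD hB 𝓑 _ _ hRic hreg hfut hT hsc U K hUo hHU hconn hKs hKill hcomm hne htan hcollar hbelt hms
  refine hD 𝓑 hRic hreg hfut hT hsc U K hUo hHU hconn hKs hKill hcomm hne htan hcollar
    (hN 𝓑 hRic hreg hfut hT hsc U K hUo hHU hconn hKs hKill hcomm hne htan hcollar hbelt ?_)
  intro S hS hSd γ s hγ hs hnull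
  by_contra hcon
  push Not at hcon
  obtain ⟨ν, ω, ψ, χ, hν, hU, hwave, hmode, hbdd, x, hx, hnz⟩ :=
    hB 𝓑 hRic hreg hfut hT hsc U K hUo hHU hconn hKs hKill hcomm hne htan hcollar hbelt S hS hSd γ s
      hγ hs hnull hcon
  have hzero := hms ν ω ψ χ hν hU hwave hmode hbdd x hx
  rcases hnz with h | h
  · exact h hzero.1
  · exact h hzero.2

end Summit.FinalStateConjecture.FinalStateConjecture.Theorems
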